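import Literature.Probability.Percolation.ArmSeparationGlue
import Literature.Probability.Percolation.SiteHarrisChain
import Literature.Probability.Percolation.TriThetaHalf
import HarnessLib

/-!
# Tubes: chains of crossed parallelograms (the RSW corridors of the arm-separation theorem)

Topic: Probability / Percolation; family `crit-perc` (critical site percolation on `𝕋`,
`P = P_{1/2} = triSitePercolation half`). A toolkit brick of the discharge of
`Literature.Probability.Percolation.Nolin2008_twoArm_separation` (Nolin 2008, Thm. 11
[arXiv 0711.4948: Thm. 10]; `ArmSeparation.lean`). The landing and extension steps of the proof
(Nolin 2008, Prop. 12 [arXiv Prop. 11]: "gluing arguments based on RSW constructions"; Kesten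
1987, Lemma 2) repeatedly build an open corridor as a finite chain of parallelograms
`[a, a+w] × [b, b+h]` of bounded aspect ratio, each crossed the long way by open sites,
consecutive ones crossing each other transversally (like a plus sign), so that consecutive
crossings meet. This file packages the bookkeeping once:

* `Tube` — a parallelogram with its crossing direction; `Tube.event` (it is crossed),
  `Tube.IsCrossing ω x y` (an explicit crossing), `Tube.box`, `Tube.sites`;
* `Tube.Crosses T T'` — the plus-sign condition; `Tube.relay` — the crossings of two crossing
  tubes are joined inside the two boxes (`PathIn.relay`);
* `Tube.chain_paths` — along a list of tubes in which consecutive tubes cross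
  (`List.IsChain Crosses`), all realised by `ω`, the start of a crossing of the first tube is
  joined to the start of a crossing of the last tube inside the union of the boxes;
* locality and monotonicity of `Tube.eventAll L` (all tubes of `L` crossed) and the RSW–Harris
  bound `Tube.pow_le_real_eventAll`: `P(eventAll L) ≥ c_ρ ^ |L|` when every tube has aspect
  ratio at most `ρ` (`tri_rsw_half_holds`, `sitePercolation_harris'`).

## References

* P. Nolin, *Near-critical percolation in two dimensions*, Electron. J. Probab. 13 (2008), §4.3,
  Prop. 12 (proof) [arXiv 0711.4948: Prop. 11]. [Nolin2008]
* H. Kesten, *Scaling relations for 2D-percolation*, Comm. Math. Phys. 109 (1987), Lemma 2. [Kesten1987]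
* G. Grimmett, *Percolation*, 2nd ed. (1999), §11.7 (RSW chaining). [GrimmettPercolation1999]

Tree: `triStrip`, `triStripFinset`, `triHCross`, `triVCross` and their API (`TriRSWChaining.lean`);
`PathIn.relay` (`ArmSeparationGlue.lean`); `sitePercolation_harris'` (`SitePercolationMeasure.lean`);
`tri_rsw_half_holds` (`TriThetaHalf.lean`); `triLRCrossingProb_anti_width`.
-/

noncomputable section

open MeasureTheory Set

namespace Literature.Probability.Percolation

open LatticeModels

/-- **A tube**: the parallelogram `[a, a+w] × [b, b+h]` of `𝕋`, to be crossed horizontally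
(`horiz = true`: from the column `a` to the column `a + w`) or vertically (from the row `b` to
the row `b + h`) by open sites. [cite: Nolin2008, §4.3 Prop. 12 (proof) (arXiv 0711.4948: Prop. 11)] -/
structure Tube where
  /-- lower-left column -/
  a : ℤ
  /-- lower-left row -/
  b : ℤ
  /-- width -/
  w : ℕ
  /-- height -/
  h : ℕ
  /-- crossing direction: horizontal (`true`) or vertical (`false`) -/
  horiz : Bool

namespace Tube

variable (T : Tube)

/-- The set of sites of the tube. [folklore] -/
def box : Set (Site 2) := triStrip T.a T.b T.w T.h

/-- The sites of the tube as a `Finset`. [folklore] -/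
def sites : Finset (Site 2) := triStripFinset T.a T.b T.w T.h

/-- `↑T.sites = T.box`. [folklore] -/
@[simp] theorem coe_sites : (↑T.sites : Set (Site 2)) = T.box := coe_triStripFinset _ _ _ _

/-- Membership in the box. [folklore] -/
theorem mem_box {v : Site 2} : v ∈ T.box ↔ T.a ≤ v 0 ∧ v 0 ≤ T.a + T.w ∧ T.b ≤ v 1 ∧ v 1 ≤ T.b + T.h := mem_triStrip

/-- **The tube is crossed** by open sites of `ω`, the prescribed way. [cite: Nolin2008, §4.3 Prop. 12 (proof) (arXiv 0711.4948: Prop. 11)] -/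
def event : Set (SiteConfig (Site 2)) := bif T.horiz then triHCross T.a T.b T.w T.h else triVCross T.a T.b T.w T.h

/-- **An explicit crossing** of the tube in `ω`: an open path of the box from the low side
(`x₀ = a`, resp. `x₁ = b`) to the high side (`x₀ = a + w`, resp. `x₁ = b + h`). [folklore] -/
def IsCrossing (ω : SiteConfig (Site 2)) (x y : Site 2) : Prop :=
  (bif T.horiz then x 0 = T.a ∧ y 0 = T.a + T.w else x 1 = T.b ∧ y 1 = T.b + T.h) ∧ PathIn triGraph (T.box ∩ ω) x y

/-- A configuration in the event has an explicit crossing. [folklore] -/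
theorem exists_isCrossing {ω : SiteConfig (Site 2)} (h : ω ∈ T.event) : ∃ x y, T.IsCrossing ω x y := by
  unfold event at h
  unfold IsCrossing box
  cases hT : T.horiz
  · rw [hT] at h; obtain ⟨x, y, hx, hy, hp⟩ := h; exact ⟨x, y, ⟨hx, hy⟩, hp⟩
  · rw [hT] at h; obtain ⟨x, y, hx, hy, hp⟩ := h; exact ⟨x, y, ⟨hx, hy⟩, hp⟩

/-- The crossing event is increasing. [folklore] -/
theorem isUpperSet_event : IsUpperSet T.event := by
  unfold event; cases T.horiz
  · exact isUpperSet_triVCross _ _ _ _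
  · exact isUpperSet_triHCross _ _ _ _

/-- The crossing event is determined by the sites of the tube. [folklore] -/
theorem determinedBy_event : DeterminedBy T.event ↑T.sites := by
  unfold event sites; cases T.horiz
  · exact determinedBy_triVCross _ _ _ _
  · exact determinedBy_triHCross _ _ _ _

/-- **Aspect ratio at most `ρ`**: the long side is at most `ρ` times the (positive) short side. [folklore] -/
def AspectLE (ρ : ℕ) : Prop := bif T.horiz then T.w ≤ ρ * T.h ∧ 1 ≤ T.h else T.h ≤ ρ * T.w ∧ 1 ≤ T.w

/-- **RSW for one tube**: if `c ≤ P_{1/2}(long-way crossing of [0, ρ n] × [0, n])` for all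
`n ≥ 1`, a tube of aspect ratio at most `ρ` is crossed with probability at least `c`. [cite: Nolin2008, §4.3 Prop. 12 (proof) (arXiv 0711.4948: Prop. 11)] -/
theorem le_real_event {ρ : ℕ} {c : ℝ}
    (hrsw : ∀ n : ℕ, 1 ≤ ⌊(ρ : ℝ) * n⌋₊ → c ≤ triLRCrossingProb half ⌊(ρ : ℝ) * n⌋₊ n) (hρ : 1 ≤ ρ)
    (hT : T.AspectLE ρ) : c ≤ (triSitePercolation half).real T.event := by
  have hfl : ∀ n : ℕ, ⌊(ρ : ℝ) * (n : ℕ)⌋₊ = ρ * n := fun n => by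
    have : (ρ : ℝ) * (n : ℕ) = ((ρ * n : ℕ) : ℝ) := by push_cast; ring
    rw [this, Nat.floor_natCast]
  have hcw : ∀ L n : ℕ, 1 ≤ n → L ≤ ρ * n → c ≤ triLRCrossingProb half L n := fun L n hn hL => by
    have h := hrsw n (by rw [hfl]; exact le_trans hn (Nat.le_mul_of_pos_left n hρ))
    rw [hfl] at h
    exact h.trans (triLRCrossingProb_anti_width half hL n)
  unfold event; unfold AspectLE at hT
  cases hh : T.horiz
  · rw [hh] at hT; simp only [cond_false] at hT ⊢
    rw [triSitePercolation_real_triVCross]; exact hcw _ _ hT.2 hT.1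
  · rw [hh] at hT; simp only [cond_true] at hT ⊢
    rw [triSitePercolation_real_triHCross]; exact hcw _ _ hT.2 hT.1

/-! ### Consecutive tubes cross -/

/-- **Plus-sign crossing** of consecutive tubes: one is horizontal, the other vertical, the
vertical one's columns lie inside the horizontal one's, and the horizontal one's rows inside the
vertical one's. [cite: Nolin2008, §4.3 Prop. 12 (proof) (arXiv 0711.4948: Prop. 11)] -/
def Crosses (T T' : Tube) : Prop :=
  (T.horiz = true ∧ T'.horiz = false ∧ T.a ≤ T'.a ∧ T'.a + T'.w ≤ T.a + T.w ∧ T'.b ≤ T.b ∧ T.b + T.h ≤ T'.b + T'.h) ∨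
    (T.horiz = false ∧ T'.horiz = true ∧ T'.a ≤ T.a ∧ T.a + T.w ≤ T'.a + T'.w ∧ T.b ≤ T'.b ∧ T'.b + T'.h ≤ T.b + T.h)

variable {T}

/-- **Relay**: the starts of crossings of two crossing tubes are joined by an open path inside
the two boxes (`PathIn.relay`). [cite: KestenPTM1982, §2.2 (paths crossing a rectangle must intersect)] -/
theorem relay {T' : Tube} (hc : Crosses T T') {ω : SiteConfig (Site 2)} {x y x' y' : Site 2}
    (h : T.IsCrossing ω x y) (h' : T'.IsCrossing ω x' y') : PathIn triGraph ((T.box ∪ T'.box) ∩ ω) x x' := by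
  obtain ⟨hs, hp⟩ := h
  obtain ⟨hs', hp'⟩ := h'
  rcases hc with ⟨hT, hT', h1, h2, h3, h4⟩ | ⟨hT, hT', h1, h2, h3, h4⟩
  · rw [hT] at hs; rw [hT'] at hs'
    simp only [cond_true, cond_false] at hs hs'
    exact PathIn.relay (L := T'.a) (R := T'.a + T'.w) (B := T.b) (T := T.b + T.h) (by omega) (by omega)
      hp (by omega) (by omega) (fun z hz _ _ => by rw [mem_box] at hz; exact ⟨hz.2.2.1, hz.2.2.2⟩)
      hp' (by omega) (by omega) (fun z hz _ _ => by rw [mem_box] at hz; exact ⟨hz.1, hz.2.1⟩)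
  · rw [hT] at hs; rw [hT'] at hs'
    simp only [cond_true, cond_false] at hs hs'
    have := PathIn.relay (L := T.a) (R := T.a + T.w) (B := T'.b) (T := T'.b + T'.h) (by omega) (by omega)
      hp' (by omega) (by omega) (fun z hz _ _ => by rw [mem_box] at hz; exact ⟨hz.2.2.1, hz.2.2.2⟩)
      hp (by omega) (by omega) (fun z hz _ _ => by rw [mem_box] at hz; exact ⟨hz.1, hz.2.1⟩)
    exact this.symm.mono fun v hv => ⟨hv.1.symm, hv.2⟩

/-! ### Chains of tubes -/

/-- **All tubes of the list are crossed.** [cite: Nolin2008, §4.3 Prop. 12 (proof) (arXiv 0711.4948: Prop. 11)] -/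
def eventAll (L : List Tube) : Set (SiteConfig (Site 2)) := {ω | ∀ T ∈ L, ω ∈ T.event}

/-- The union of the boxes of a list of tubes. [folklore] -/
def boxAll (L : List Tube) : Set (Site 2) := {v | ∃ T ∈ L, v ∈ T.box}

/-- The sites of a list of tubes. [folklore] -/
def sitesAll (L : List Tube) : Finset (Site 2) := L.foldr (fun T S => T.sites ∪ S) ∅

/-- Membership in `sitesAll`. [folklore] -/
theorem mem_sitesAll {L : List Tube} {v : Site 2} : v ∈ sitesAll L ↔ ∃ T ∈ L, v ∈ T.sites := by
  induction L with
  | nil => simp [sitesAll]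
  | cons T L ih =>
    simp only [sitesAll, List.foldr_cons, Finset.mem_union, List.mem_cons, exists_eq_or_imp]
    rw [← ih]; rfl

/-- `↑(sitesAll L) = boxAll L`. [folklore] -/
theorem coe_sitesAll (L : List Tube) : (↑(sitesAll L) : Set (Site 2)) = boxAll L := by
  ext v
  rw [Finset.mem_coe, mem_sitesAll]
  simp only [boxAll, Set.mem_setOf_eq]
  refine exists_congr fun T => and_congr_right fun _ => ?_
  rw [← Finset.mem_coe, coe_sites]

/-- A box of the list lies in the union. [folklore] -/
theorem box_subset_boxAll {L : List Tube} {T : Tube} (hT : T ∈ L) : T.box ⊆ boxAll L := fun _ hv => ⟨T, hT, hv⟩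

/-- `eventAll` is increasing. [folklore] -/
theorem isUpperSet_eventAll (L : List Tube) : IsUpperSet (eventAll L) :=
  fun _ _ hle h T hT => T.isUpperSet_event hle (h T hT)

/-- `eventAll L` is determined by the sites of the tubes. [folklore] -/
theorem determinedBy_eventAll (L : List Tube) : DeterminedBy (eventAll L) ↑(sitesAll L) := by
  rw [determinedBy_iff]
  intro ω ω' hω
  have key : ∀ T ∈ L, (ω ∈ T.event ↔ ω' ∈ T.event) := fun T hT =>
    (determinedBy_iff _ _).1 T.determinedBy_event ω ω' (by
      have hsub : (↑T.sites : Set (Site 2)) ⊆ ↑(sitesAll L) := fun v hv =>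
        Finset.mem_coe.2 (mem_sitesAll.2 ⟨T, hT, Finset.mem_coe.1 hv⟩)
      rw [← Set.inter_eq_self_of_subset_right hsub, ← Set.inter_assoc, hω, Set.inter_assoc])
  exact ⟨fun h T hT => (key T hT).1 (h T hT), fun h T hT => (key T hT).2 (h T hT)⟩

/-- **RSW–Harris for a chain of tubes**: if `c ≤ P_{1/2}(long-way crossing of
[0, ρ n] × [0, n])` for all `n ≥ 1` (`0 ≤ c`) and every tube of `L` has aspect ratio at most `ρ`,
then `P(eventAll L) ≥ c ^ |L|`. [cite: Nolin2008, §4.3 Prop. 12 (proof) (arXiv 0711.4948: Prop. 11)] -/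
theorem pow_le_real_eventAll {ρ : ℕ} {c : ℝ}
    (hrsw : ∀ n : ℕ, 1 ≤ ⌊(ρ : ℝ) * n⌋₊ → c ≤ triLRCrossingProb half ⌊(ρ : ℝ) * n⌋₊ n) (hρ : 1 ≤ ρ) (hc : 0 ≤ c) :
    ∀ L : List Tube, (∀ T ∈ L, T.AspectLE ρ) → c ^ L.length ≤ (triSitePercolation half).real (eventAll L)
  | [], _ => by
    have : eventAll [] = Set.univ := by ext ω; simp [eventAll]
    rw [this, List.length_nil, pow_zero]
    exact (probReal_univ (μ := triSitePercolation half)).symm.le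
  | T :: L, hasp => by
    have ih := pow_le_real_eventAll hrsw hρ hc L fun T' hT' => hasp T' (List.mem_cons_of_mem _ hT')
    have hT := T.le_real_event hrsw hρ (hasp T List.mem_cons_self)
    have hsplit : eventAll (T :: L) = T.event ∩ eventAll L := by
      ext ω; simp [eventAll]
    have hH := sitePercolation_harris' half T.determinedBy_event (determinedBy_eventAll L) T.isUpperSet_event
      (isUpperSet_eventAll L)
    unfold triSitePercolation at ih hT ⊢
    rw [hsplit, List.length_cons, pow_succ, mul_comm]
    exact (mul_le_mul hT ih (pow_nonneg hc _) measureReal_nonneg).trans hH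

/-- **Chains of crossing tubes carry an open path**: if consecutive tubes of `T₀ :: L` cross
(`List.IsChain Crosses`) and all are crossed by `ω`, then for every explicit crossing of the
first tube there is an explicit crossing of the last tube whose start is joined to the start of
the first one by an open path inside the union of the boxes. [cite: Nolin2008, §4.3 Prop. 12 (proof) (arXiv 0711.4948: Prop. 11)] -/
theorem chain_paths {ω : SiteConfig (Site 2)} :
    ∀ (T₀ : Tube) (L : List Tube), List.IsChain Crosses (T₀ :: L) → (∀ T ∈ T₀ :: L, ω ∈ T.event) →
      ∀ x₀ y₀ : Site 2, T₀.IsCrossing ω x₀ y₀ →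
        ∃ xn yn : Site 2, ((T₀ :: L).getLast (List.cons_ne_nil _ _)).IsCrossing ω xn yn ∧
          PathIn triGraph (boxAll (T₀ :: L) ∩ ω) x₀ xn
  | T₀, [], _, _, x₀, y₀, h₀ => ⟨x₀, y₀, h₀, PathIn.refl ⟨⟨T₀, List.mem_cons_self, h₀.2.left_mem.1⟩, h₀.2.left_mem.2⟩⟩
  | T₀, T₁ :: L, hch, hω, x₀, y₀, h₀ => by
    have hc : Crosses T₀ T₁ := hch.rel
    have hch' : List.IsChain Crosses (T₁ :: L) := hch.tail
    obtain ⟨x₁, y₁, h₁⟩ := T₁.exists_isCrossing (hω T₁ (List.mem_cons_of_mem _ List.mem_cons_self))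
    obtain ⟨xn, yn, hn, hp⟩ := chain_paths T₁ L hch' (fun T hT => hω T (List.mem_cons_of_mem _ hT)) x₁ y₁ h₁
    have hlast : (T₀ :: T₁ :: L).getLast (List.cons_ne_nil _ _) = (T₁ :: L).getLast (List.cons_ne_nil _ _) :=
      List.getLast_cons (List.cons_ne_nil _ _)
    refine ⟨xn, yn, hlast ▸ hn, ?_⟩
    have r := relay hc h₀ h₁
    refine (r.mono ?_).trans (hp.mono ?_)
    · rintro v ⟨hv | hv, hvω⟩
      · exact ⟨⟨T₀, List.mem_cons_self, hv⟩, hvω⟩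
      · exact ⟨⟨T₁, List.mem_cons_of_mem _ List.mem_cons_self, hv⟩, hvω⟩
    · rintro v ⟨⟨T, hT, hv⟩, hvω⟩
      exact ⟨⟨T, List.mem_cons_of_mem _ hT, hv⟩, hvω⟩

end Tube

end Literature.Probability.Percolation
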